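import Literature.Analysis.FluidPDE.AxisymNoSwirlVorticity
import Literature.Analysis.FluidPDE.CylindricalIntegration
import HarnessLib

/-!
# Gallay–Šverák 2015, Theorem 1.1: global solutions of the axisymmetric Navier–Stokes equations
# WITHOUT swirl from azimuthal vorticity in the scale-invariant space `L¹(Ω)` — the rough-data
# companion of `axisymmetric_no_swirl_global_regularity` (smooth `H^∞` data)

Topic `Literature/Analysis/FluidPDE`. Statements file: ONE named fact (D-0014, cite-tagged,
unproved here), one definition (the paper's norm `‖ω_θ‖_{L¹(Ω)}` written on `ℝ³`), and elementary
PROVED consequences. Companion of `AxisymNoSwirlScaleInvariantBounds.lean`, which vendors the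
same paper's Prop. 2.6, Lemma 6.4, (1.11) and (1.12) for Tao's SMOOTH finite-energy class and
records "TODO(general form): data `ω₀ ∈ L¹(Ω)` of infinite energy … not vendored" — this file
vendors that general EXISTENCE statement, which is the one the viscous fate of the `C^{1,α}`
swirl-free Euler blow-up data needs (those data have bounded compactly supported vorticity, hence
`ω₀ ∈ L¹(Ω)`, but are not smooth: `AxisymNoSwirlHolderThreshold.lean`,
`HolderThresholdSelfSimilarBlowup.lean`, `HolderEulerNonSelfSimilarBlowup.lean`).

Source: Th. Gallay, V. Šverák, *Remarks on the Cauchy problem for the axisymmetric Navier–Stokes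
equations*, Confluentes Math. 7 (2015) 67–92 = arXiv:1510.01036 `[GallaySverak2016]` ("p." =
page of the arXiv version = chunk of the held text `paper:arxiv-1510.01036`).

## The printed statement (p. 3–4, 15, 17)

Setting (p. 3): the axisymmetric Navier–Stokes equations without swirl, viscosity `1`; "the flow
is entirely determined by the single quantity `ω_θ`, because the velocity field `u` can be
reconstructed by … the axisymmetric Biot–Savart law" ((1.3), §2: (2.8) is the Biot–Savart law of
`ℝ³` for `ω = ω_θ e_θ`); the vorticity equation (1.4)
`∂ₜω_θ + u·∇ω_θ − (u_r/r)ω_θ = Δω_θ − ω_θ/r²` on the half-plane `Ω = {(r,z) : r > 0}`, which is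
equipped "with the two-dimensional measure `dr dz`" and the norms
`‖ω_θ‖_{L^p(Ω)} = (∫_Ω |ω_θ|^p dr dz)^{1/p}` ((1.5), p. 4). **Theorem 1.1** (p. 4): "For any
initial data `ω₀ ∈ L¹(Ω)`, the axisymmetric vorticity equation (1.4) has a unique global mild
solution `ω_θ ∈ C⁰([0,∞),L¹(Ω)) ∩ C⁰((0,∞),L^∞(Ω))`. The solution satisfies
`‖ω_θ(t)‖_{L¹(Ω)} ≤ ‖ω₀‖_{L¹(Ω)}` for all `t > 0`, and
`lim_{t→0} t^{1−1/p}‖ω_θ(t)‖_{L^p(Ω)} = 0` for `1 < p ≤ ∞`,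
`lim_{t→∞} t^{1−1/p}‖ω_θ(t)‖_{L^p(Ω)} = 0` for `1 ≤ p ≤ ∞`" ((1.10); the finite-impulse
asymptotics (1.13) is not vendored). Discussion (p. 4): "any solution of (1.4) with initial data
`ω₀ ∈ L¹(Ω)` satisfies `‖ω_θ(t)‖_{L¹(Ω)} ≤ ‖ω₀‖_{L¹(Ω)}` for all `t > 0` and
(1.11) `sup_{t>0} t‖ω_θ(t)‖_{L^∞(Ω)} ≤ C(‖ω₀‖_{L¹(Ω)})`, where `C(s) = O(s)` as `s → 0` … we also
deduce (1.12) `sup_{t>0} t^{1/2}‖u(t)‖_{L^∞(Ω)} ≤ C(‖ω₀‖_{L¹(Ω)})`." **Remark 4.6** (p. 15): "The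
solutions constructed in Propositions 4.1 and 4.3 are in fact smooth for positive times, and
satisfy the axisymmetric vorticity equation (4.1) in the classical sense" (standard smoothing,
[KNSS]); Remark 5.4 (p. 17): they are global.

## Rendering

Dictionary (as in `AxisymNoSwirlScaleInvariantBounds.lean`): `dx = r dr dθ dz`, so for an
azimuthal field `ω = ω_θ(r,z) e_θ` on `ℝ³`, `‖ω_θ‖_{L¹(Ω)} = ∫_{ℝ³} ‖ω(x)‖ (2π r(x))⁻¹ dx`
(`GallaySverak2015.l1OmegaNorm ω`, an extended non-negative real), `‖ω_θ‖_{L^∞(Ω)} = sup ‖ω‖`.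
The DATUM is an azimuthal vorticity field `ω₀ : ℝ³ → ℝ³` — axisymmetric (`IsAxisymmetric ω₀`),
with zero radial and axial parts (`x₀(ω₀)₀ + x₁(ω₀)₁ = 0`, `(ω₀)₂ = 0`), a.e.-strongly measurable,
`l1OmegaNorm ω₀ < ∞` — i.e. `ω₀ = ω₀^θ(r,z) e_θ` with `ω₀^θ ∈ L¹(Ω)`. The SOLUTION is rendered in
the tree's velocity form: a classical Navier–Stokes solution `(u, p)` on `(0, ∞) × ℝ³`
(`IsClassicalNSSolutionOn (Ioi 0) 1 0 u p`: jointly smooth, `∂ₜu + (u·∇)u = Δu − ∇p`, `div u = 0`)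
whose slices are axisymmetric without swirl and are the Biot–Savart velocity of their vorticity
(`u t = biotSavart (curl (u t))`, the paper's (1.3)/(2.8)), with bounded vorticity in `L¹(Ω)` at
each `t > 0` (`C⁰((0,∞),L^∞(Ω))` ∋ `ω_θ`), attaining the datum in `L¹(Ω)`
(`‖ω_θ(t) − ω₀^θ‖_{L¹(Ω)} → 0` as `t → 0⁺`) and continuous in `L¹(Ω)` at positive times
(`C⁰([0,∞),L¹(Ω))`), and obeying `‖ω_θ(t)‖_{L¹(Ω)} ≤ ‖ω₀‖_{L¹(Ω)}`, (1.10) for `p = ∞` (both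
limits) and `p = 1` (at `∞`), (1.11) and (1.12) with one function `C`, `C(s) ≤ Ks` on some
`[0, δ]`. (For jointly smooth `u = BS[ω]` the classical vorticity equation (Remark 4.6) is the
curl of the momentum equation, and a smooth curl-free field on `ℝ³` is a gradient — this is how
the pressure `p` enters; the paper's system is (1.1) `∂ₜu + (u·∇)u = Δu − ∇p`, `div u = 0`, p. 2.)
Not rendered: UNIQUENESS (it is stated among mild solutions of the integral equation (4.2), whose
semigroup (3.2) is not in the tree), the mild formulation itself, (1.10) for `1 < p < ∞`, the
time-continuity in `L^∞(Ω)`, finite measures as data (Thm. 1.3), the asymptotics (1.13).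
General viscosity `ν > 0` follows by the scaling `u ↦ ν u(νt, ·)` (not spelled out; the paper
sets `ν = 1`).

Proved: `l1OmegaNorm_zero`; from the fact, NO vorticity blow-up at any positive time
(`L1VorticityGlobalExistence.not_vorticityBlowsUpAt`: (1.11) gives `‖ω(t,x)‖ ≤ C(M)/t ≤ 2C(M)/T` for
`t ∈ (T/2, T)`) — to be read against `VorticityBlowsUpAt` in the inviscid statements
`Shkoller2026.noSwirlTypeIBlowup`, `Chen2026.asymptSelfSimilarBlowup`,
`CordobaMartinezZoroaZheng2023.holderEulerBlowup` for data of the same symmetry class; and the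
bridge from those data to the paper's datum class: an axisymmetric field with zero axial part
vanishes on the axis (`eq_zero_of_cylRadius_eq_zero`), a continuous compactly supported field
vanishing on the axis has `‖ω_θ‖_{L¹(Ω)} < ∞` (`l1OmegaNorm_lt_top_of_hasCompactSupport`, from the
local integrability of `1/r`, `integrableOn_inv_cylRadius_solidCylinder`), whence
`L1VorticityGlobalExistence.of_noSwirlDatum`: for every `C¹` axisymmetric swirl-free velocity
datum with compactly supported vorticity the fact yields a global classical viscous solution,
axisymmetric without swirl, attaining `curl u₀` in `L¹(Ω)`, with no vorticity blow-up.

## What this is NOT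

Not a statement about data with swirl, nor about uniqueness / the identification with Leray or
Kato solutions from a velocity datum (GS15 discuss Giga–Miyakawa `M^{3/2}` and Koch–Tataru
`BMO⁻¹` on p. 4; not vendored); the Euler (`ν = 0`) problem for the same data blows up
(the files cited above).
-/

noncomputable section

open MeasureTheory Set Function Filter
open _root_.Topology
open scoped NNReal ENNReal

namespace Literature.Analysis.FluidPDE

namespace GallaySverak2015

/-- **The scale-invariant norm `‖ω_θ‖_{L¹(Ω)}` of Gallay–Šverák, written on `ℝ³`.** For an
azimuthal field `ω = ω_θ(r,z) e_θ`, `∫_Ω |ω_θ| dr dz = ∫_{ℝ³} ‖ω(x)‖ (2π r(x))⁻¹ dx`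
(`dx = 2π r dr dz` after the angular integration); an extended non-negative real (the datum class
of Theorem 1.1 is `l1OmegaNorm ω₀ < ∞`). [cite: GallaySverak2016, (1.5) (arXiv p. 4): Ω = {r > 0} with the measure dr dz] -/
def l1OmegaNorm (ω : EuclideanSpace ℝ (Fin 3) → EuclideanSpace ℝ (Fin 3)) : ℝ≥0∞ :=
  ∫⁻ x, ‖ω x‖ₑ / ENNReal.ofReal (2 * Real.pi * cylRadius x)

/-- The zero field has `‖0‖_{L¹(Ω)} = 0` (unfolding of the norm (1.5)). [cite: GallaySverak2016, (1.5) (arXiv p. 4)] -/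
@[simp]
theorem l1OmegaNorm_zero : l1OmegaNorm (0 : EuclideanSpace ℝ (Fin 3) → EuclideanSpace ℝ (Fin 3)) = 0 := by
  simp [l1OmegaNorm]

/-- **Gallay–Šverák 2015, Theorem 1.1 (existence, regularity, bounds) with Remark 4.6 and
(1.11)–(1.12).** Printed (arXiv p. 4): "For any initial data `ω₀ ∈ L¹(Ω)`, the axisymmetric
vorticity equation (1.4) has a unique global mild solution
`ω_θ ∈ C⁰([0,∞),L¹(Ω)) ∩ C⁰((0,∞),L^∞(Ω))`. The solution satisfies
`‖ω_θ(t)‖_{L¹(Ω)} ≤ ‖ω₀‖_{L¹(Ω)}` for all `t > 0`, and `lim_{t→0} t^{1−1/p}‖ω_θ(t)‖_{L^p(Ω)} = 0`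
(`1 < p ≤ ∞`), `lim_{t→∞} t^{1−1/p}‖ω_θ(t)‖_{L^p(Ω)} = 0` (`1 ≤ p ≤ ∞`)"; p. 4: "any solution …
satisfies `sup_{t>0} t‖ω_θ(t)‖_{L^∞(Ω)} ≤ C(‖ω₀‖_{L¹(Ω)})`, where `C(s) = O(s)` as `s → 0` …
`sup_{t>0} t^{1/2}‖u(t)‖_{L^∞(Ω)} ≤ C(‖ω₀‖_{L¹(Ω)})`"; Remark 4.6 (p. 15): the solutions "are in
fact smooth for positive times, and satisfy the axisymmetric vorticity equation in the classical
sense"; setting: no swirl, viscosity `1`, `u` the Biot–Savart velocity of `ω_θ e_θ` (p. 3, (2.8)).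
**Rendering** (module docstring; uniqueness and the mild formulation NOT rendered): there is
`C : ℝ → ℝ` with `C(s) ≤ Ks` on some `[0, δ]`, `δ > 0`, such that for every azimuthal axisymmetric
a.e.-strongly measurable datum `ω₀` with `M = ‖ω₀^θ‖_{L¹(Ω)} < ∞` there is a classical solution
`(u, p)` of Navier–Stokes (`ν = 1`, `f = 0`) on `(0,∞) × ℝ³`, axisymmetric without swirl, with
`u(t) = BS[ω(t)]`, `ω(t) = curl u(t)` bounded and in `L¹(Ω)` for `t > 0`, `ω(t) → ω₀` in `L¹(Ω)`
as `t → 0⁺`, `t ↦ ω(t)` continuous in `L¹(Ω)` on `(0,∞)`, `‖ω_θ(t)‖_{L¹(Ω)} ≤ M`,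
`t‖ω(t,x)‖ ≤ C(M)`, `√t‖u(t,x)‖ ≤ C(M)`, `t·sup‖ω(t)‖ → 0` as `t → 0⁺` and as `t → ∞`, and
`‖ω_θ(t)‖_{L¹(Ω)} → 0` as `t → ∞`.
[cite: GallaySverak2016, Thm. 1.1 with (1.10)–(1.12) (arXiv p. 4), Rem. 4.6 (p. 15), Rem. 5.4 (p. 17)] -/
def L1VorticityGlobalExistence : Prop :=
  ∃ C : ℝ → ℝ, (∃ K δ : ℝ, 0 < δ ∧ ∀ s, 0 ≤ s → s ≤ δ → C s ≤ K * s) ∧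
    ∀ ω₀ : EuclideanSpace ℝ (Fin 3) → EuclideanSpace ℝ (Fin 3),
      AEStronglyMeasurable ω₀ volume → IsAxisymmetric ω₀ →
      (∀ x, x 0 * ω₀ x 0 + x 1 * ω₀ x 1 = 0) → (∀ x, ω₀ x 2 = 0) → l1OmegaNorm ω₀ < ⊤ →
      ∃ (u : ℝ → EuclideanSpace ℝ (Fin 3) → EuclideanSpace ℝ (Fin 3))
        (p : ℝ → EuclideanSpace ℝ (Fin 3) → ℝ),
        -- smooth for positive times, Navier–Stokes (ν = 1) classically, global
        IsClassicalNSSolutionOn (Ioi 0) 1 0 u p ∧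
        -- axisymmetric without swirl; velocity = Biot–Savart of its vorticity; ω(t) ∈ L¹ ∩ L^∞(Ω)
        (∀ t, 0 < t → IsAxisymmetric (u t) ∧ HasNoSwirl (u t) ∧ u t = biotSavart (curl (u t)) ∧
          l1OmegaNorm (curl (u t)) ≤ l1OmegaNorm ω₀ ∧ ∃ B : ℝ, ∀ x, ‖curl (u t) x‖ ≤ B) ∧
        -- the datum is attained in L¹(Ω), and t ↦ ω_θ(t) is continuous in L¹(Ω) on (0, ∞)
        Tendsto (fun t => l1OmegaNorm (fun x => curl (u t) x - ω₀ x)) (𝓝[>] 0) (𝓝 0) ∧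
        (∀ t₀, 0 < t₀ →
          Tendsto (fun t => l1OmegaNorm (fun x => curl (u t) x - curl (u t₀) x)) (𝓝 t₀) (𝓝 0)) ∧
        -- (1.11) and (1.12), M = ‖ω₀‖_{L¹(Ω)}
        (∀ t, 0 < t → ∀ x, t * ‖curl (u t) x‖ ≤ C (l1OmegaNorm ω₀).toReal ∧
          Real.sqrt t * ‖u t x‖ ≤ C (l1OmegaNorm ω₀).toReal) ∧
        -- (1.10), p = ∞, at t → 0⁺ and at t → ∞
        (∀ ε, 0 < ε → ∃ δ, 0 < δ ∧ ∀ t, 0 < t → t < δ → ∀ x, t * ‖curl (u t) x‖ ≤ ε) ∧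
        (∀ ε, 0 < ε → ∃ R, ∀ t, R < t → ∀ x, t * ‖curl (u t) x‖ ≤ ε) ∧
        -- (1.10), p = 1, at t → ∞
        Tendsto (fun t => l1OmegaNorm (curl (u t))) atTop (𝓝 0)

/-- **No vorticity blow-up at any positive time** for the Gallay–Šverák solution: from (1.11),
`‖ω(t, x)‖ ≤ C(M)/t ≤ 2C(M)/T` on `(T/2, T)`, so `VorticityBlowsUpAt u T` fails for every `T > 0`
— in contrast with the inviscid statements for data of the same class (`Shkoller2026`, `Chen2026`,
`CordobaMartinezZoroaZheng2023`). [cite: GallaySverak2016, (1.11) (arXiv p. 4)] -/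
theorem L1VorticityGlobalExistence.not_vorticityBlowsUpAt (h : L1VorticityGlobalExistence)
    {ω₀ : EuclideanSpace ℝ (Fin 3) → EuclideanSpace ℝ (Fin 3)} (hm : AEStronglyMeasurable ω₀ volume)
    (hax : IsAxisymmetric ω₀) (hrad : ∀ x, x 0 * ω₀ x 0 + x 1 * ω₀ x 1 = 0) (haxial : ∀ x, ω₀ x 2 = 0)
    (hL1 : l1OmegaNorm ω₀ < ⊤) :
    ∃ (u : ℝ → EuclideanSpace ℝ (Fin 3) → EuclideanSpace ℝ (Fin 3))
      (p : ℝ → EuclideanSpace ℝ (Fin 3) → ℝ),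
      IsClassicalNSSolutionOn (Ioi 0) 1 0 u p ∧
      (∀ t, 0 < t → IsAxisymmetric (u t) ∧ HasNoSwirl (u t)) ∧
      Tendsto (fun t => l1OmegaNorm (fun x => curl (u t) x - ω₀ x)) (𝓝[>] 0) (𝓝 0) ∧
      ∀ T, 0 < T → ¬ VorticityBlowsUpAt u T := by
  obtain ⟨C, -, hC⟩ := h
  obtain ⟨u, p, hns, hsym, h0, -, hbd, -, -, -⟩ := hC ω₀ hm hax hrad haxial hL1
  refine ⟨u, p, hns, fun t ht => ⟨(hsym t ht).1, (hsym t ht).2.1⟩, h0, fun T hT hblow => ?_⟩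
  set M : ℝ := C (l1OmegaNorm ω₀).toReal with hM
  -- on (T/2, T) the vorticity is bounded by 2 M / T
  obtain ⟨t, ⟨x, hx⟩, ht⟩ := ((hblow (2 * M / T)).and_eventually
    (Ioo_mem_nhdsLT (show T / 2 < T by linarith))).exists
  have ht0 : 0 < t := by linarith [ht.1]
  have h1 : t * ‖curl (u t) x‖ ≤ M := (hbd t ht0 x).1
  have h2 : T / 2 * ‖curl (u t) x‖ ≤ t * ‖curl (u t) x‖ :=
    mul_le_mul_of_nonneg_right ht.1.le (norm_nonneg _)
  have h3 : 2 * M / T < ‖curl (u t) x‖ := hx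
  have h4 : 2 * M / T * (T / 2) = M := by field_simp
  nlinarith [mul_lt_mul_of_pos_right h3 (show 0 < T / 2 by linarith)]

/-- An axisymmetric vector field with vanishing axial component vanishes on the axis (the azimuthal
fields `ω = ω_θ e_θ` of the paper are `0` at `r = 0`). [cite: GallaySverak2016, §1 (arXiv p. 3): ω = ω_θ e_θ with Dirichlet condition at r = 0] -/
theorem eq_zero_of_cylRadius_eq_zero {ω : EuclideanSpace ℝ (Fin 3) → EuclideanSpace ℝ (Fin 3)}
    (hax : IsAxisymmetric ω) (h2 : ∀ x, ω x 2 = 0) {x : EuclideanSpace ℝ (Fin 3)}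
    (hx : cylRadius x = 0) : ω x = 0 := by
  obtain ⟨h0, h1⟩ := (cylRadius_eq_zero_iff x).1 hx
  have hfix : rotZ Real.pi x = x := by
    ext i; fin_cases i <;> simp [h0, h1]
  have key := hax Real.pi x
  rw [hfix] at key
  have k0 := congrFun (congrArg (fun v : EuclideanSpace ℝ (Fin 3) => (v : Fin 3 → ℝ)) key) 0
  have k1 := congrFun (congrArg (fun v : EuclideanSpace ℝ (Fin 3) => (v : Fin 3 → ℝ)) key) 1
  simp only [rotZ_apply_zero, rotZ_apply_one, Real.cos_pi, Real.sin_pi] at k0 k1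
  have h0' : ω x 0 = 0 := by simp at k0; linarith
  have h1' : ω x 1 = 0 := by simp at k1; linarith
  have h2' : ω x 2 = 0 := h2 x
  ext i
  fin_cases i
  · simpa using h0'
  · simpa using h1'
  · simpa using h2'

/-- `r(x) ≤ ‖x‖` (plumbing for the support estimate). [folklore] -/
private theorem cylRadius_le_norm_aux (x : EuclideanSpace ℝ (Fin 3)) : cylRadius x ≤ ‖x‖ := by
  rw [cylRadius, EuclideanSpace.norm_eq]
  apply Real.sqrt_le_sqrt
  simp only [Fin.sum_univ_three, Real.norm_eq_abs, sq_abs]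
  nlinarith [sq_nonneg (x 2)]

/-- `|x₂| ≤ ‖x‖` (plumbing for the support estimate). [folklore] -/
private theorem abs_apply_two_le_norm_aux (x : EuclideanSpace ℝ (Fin 3)) : |x 2| ≤ ‖x‖ := by
  rw [EuclideanSpace.norm_eq, ← Real.sqrt_sq_eq_abs]
  apply Real.sqrt_le_sqrt
  simp only [Fin.sum_univ_three, Real.norm_eq_abs, sq_abs]
  nlinarith [sq_nonneg (x 0), sq_nonneg (x 1)]

/-- **Bounded compactly supported azimuthal vorticities are in `L¹(Ω)`**: a continuous compactly
supported field vanishing on the axis has `‖ω_θ‖_{L¹(Ω)} = ∫‖ω‖(2πr)⁻¹dx < ∞`, because `1/r` is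
locally integrable in `ℝ³` (`integrableOn_inv_cylRadius_solidCylinder`). This is why the datum class
of Theorem 1.1 contains the `C^{1,α}` blow-up data of the inviscid problem. [cite: GallaySverak2016, Thm. 1.1 hypothesis ω₀ ∈ L¹(Ω) (arXiv p. 4)] -/
theorem l1OmegaNorm_lt_top_of_hasCompactSupport
    {ω : EuclideanSpace ℝ (Fin 3) → EuclideanSpace ℝ (Fin 3)} (hc : Continuous ω)
    (hK : HasCompactSupport ω) (h0 : ∀ x, cylRadius x = 0 → ω x = 0) : l1OmegaNorm ω < ⊤ := by
  obtain ⟨B, hB⟩ := hc.bounded_above_of_compact_support hK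
  have hB0 : 0 ≤ B := (norm_nonneg _).trans (hB 0)
  obtain ⟨R, hR⟩ : ∃ R, ∀ x, ω x ≠ 0 → ‖x‖ ≤ R := by
    obtain ⟨R, hR⟩ := (hK.isCompact.isBounded).exists_norm_le
    exact ⟨R, fun x hx => hR x (subset_tsupport _ hx)⟩
  have hsub : ∀ x, ω x ≠ 0 → x ∈ solidCylinder R R := fun x hx =>
    ⟨(cylRadius_le_norm_aux x).trans (hR x hx),
      (abs_apply_two_le_norm_aux x).trans (hR x hx)⟩
  have hint := integrableOn_inv_cylRadius_solidCylinder R R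
  -- pointwise domination by an integrable function
  have hpt : ∀ x, ‖ω x‖ₑ / ENNReal.ofReal (2 * Real.pi * cylRadius x) ≤
      ‖(solidCylinder R R).indicator (fun x => B / (2 * Real.pi) * (cylRadius x)⁻¹) x‖ₑ := by
    intro x
    by_cases hx : ω x = 0
    · simp [hx]
    by_cases hr : cylRadius x = 0
    · exact absurd (h0 x hr) hx
    have hrpos : 0 < cylRadius x := lt_of_le_of_ne (cylRadius_nonneg x) (Ne.symm hr)
    have h2π : 0 < 2 * Real.pi * cylRadius x := by positivity
    rw [indicator_of_mem (hsub x hx), ENNReal.div_le_iff (by simpa using h2π) ENNReal.ofReal_ne_top]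
    have hval : 0 ≤ B / (2 * Real.pi) * (cylRadius x)⁻¹ := by positivity
    rw [Real.enorm_eq_ofReal hval, ← ENNReal.ofReal_mul hval, ← ofReal_norm]
    refine ENNReal.ofReal_le_ofReal ?_
    calc ‖ω x‖ ≤ B := hB x
      _ = B / (2 * Real.pi) * (cylRadius x)⁻¹ * (2 * Real.pi * cylRadius x) := by
          field_simp
  calc l1OmegaNorm ω ≤ ∫⁻ x, ‖(solidCylinder R R).indicator
        (fun x => B / (2 * Real.pi) * (cylRadius x)⁻¹) x‖ₑ := lintegral_mono hpt
    _ < ⊤ := by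
        have hI : IntegrableOn (fun x => B / (2 * Real.pi) * (cylRadius x)⁻¹) (solidCylinder R R) :=
          hint.const_mul (B / (2 * Real.pi))
        exact hasFiniteIntegral_iff_enorm.1
          (hI.integrable_indicator (measurableSet_solidCylinder R R)).hasFiniteIntegral


/-- **The viscous fate of the swirl-free `C^{1,α}` blow-up data, at cite level.** From the fact:
for every `C¹` axisymmetric swirl-free velocity datum `u₀` on `ℝ³` with compactly supported
vorticity (the data of `Danchin2007.noSwirlHolderGlobal`, `Chen2026.asymptSelfSimilarBlowup`,
`CordobaMartinezZoroaZheng2023.holderEulerBlowup`, EGM's compact-support data), the vorticity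
`ω₀ = curl u₀` is an admissible Gallay–Šverák datum (azimuthal: `inner_curl_horizontal_eq_zero`,
`curl_apply_two_eq_zero`; axisymmetric: `IsAxisymmetric.curl`; in `L¹(Ω)`:
`l1OmegaNorm_lt_top_of_hasCompactSupport`), so the Navier–Stokes problem (`ν = 1`) has a global
classical solution on `(0,∞) × ℝ³`, axisymmetric without swirl, whose vorticity attains `ω₀` in
`L¹(Ω)` and never blows up (`¬ VorticityBlowsUpAt u T` for all `T > 0`). Uniqueness / attainment of
the velocity datum are not part of the rendered fact. [cite: GallaySverak2016, Thm. 1.1 (arXiv p. 4) with Rem. 4.6 (p. 15)] -/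
theorem L1VorticityGlobalExistence.of_noSwirlDatum (h : L1VorticityGlobalExistence)
    {u₀ : EuclideanSpace ℝ (Fin 3) → EuclideanSpace ℝ (Fin 3)} (hu : ContDiff ℝ 1 u₀)
    (hax : IsAxisymmetric u₀) (hsw : HasNoSwirl u₀) (hK : HasCompactSupport (curl u₀)) :
    ∃ (u : ℝ → EuclideanSpace ℝ (Fin 3) → EuclideanSpace ℝ (Fin 3))
      (p : ℝ → EuclideanSpace ℝ (Fin 3) → ℝ),
      IsClassicalNSSolutionOn (Ioi 0) 1 0 u p ∧
      (∀ t, 0 < t → IsAxisymmetric (u t) ∧ HasNoSwirl (u t)) ∧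
      Tendsto (fun t => l1OmegaNorm (fun x => curl (u t) x - curl u₀ x)) (𝓝[>] 0) (𝓝 0) ∧
      ∀ T, 0 < T → ¬ VorticityBlowsUpAt u T := by
  have hd : Differentiable ℝ u₀ := hu.differentiable one_ne_zero
  have hax' : IsAxisymmetric (curl u₀) := hax.curl hd
  have hrad : ∀ x, x 0 * curl u₀ x 0 + x 1 * curl u₀ x 1 = 0 := fun x =>
    inner_curl_horizontal_eq_zero hax hsw (hd x)
  have haxial : ∀ x, curl u₀ x 2 = 0 := curl_apply_two_eq_zero hax hsw hu
  exact h.not_vorticityBlowsUpAt (continuous_curl hu).aestronglyMeasurable hax' hrad haxial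
    (l1OmegaNorm_lt_top_of_hasCompactSupport (continuous_curl hu) hK
      fun x hx => eq_zero_of_cylRadius_eq_zero hax' haxial hx)

end GallaySverak2015

end Literature.Analysis.FluidPDE
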